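import Literature.AlgebraicGeometry.Resolution.HypersurfaceRestriction
import Literature.AlgebraicGeometry.Resolution.BlowupsLocal
import Literature.AlgebraicGeometry.Resolution.AlterationsNormalFormStrictTransform
import HarnessLib

/-!
# The restriction property of blow-ups, given that the exceptional divisor restricts to a Cartier divisor on the
# controlled transform (BGMW 2011 §4 Remark (3), any codimension — the formal half)

Topic: `Literature/AlgebraicGeometry/Resolution`. Bierstone–Grigoriev–Milman–Włodarczyk, arXiv:1206.3090, **§4,
Remark (3)** (p. 11): "If `X` is a smooth variety containing a smooth subvariety `Y ⊂ X`, which contains the center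
`C ⊂ Y` then the blow-up `σ_{C,Y} : Ỹ → Y` at `C` coincides with the strict transform of `Y` under the blow-up
`σ_{C,X} : X̃ → X`."; Görtz–Wedhorn I, Prop. 13.91 (1) / 13.96 (2) (the strict transform `Bl_{C∩Y}(Y) → Bl_C(X)`).

`HypersurfaceRestriction.lean` PROVES this for a regular HYPERSURFACE `Y = V(H)` by (a) a local computation — the
exceptional divisor `D` restricts to an effective Cartier divisor on `V(H')`, `H' = (π^*H : 𝓘(D))` the controlled
transform with exponent `1` — and (b) a formal universal-property argument. This file isolates (b): for ANY ideal
sheaves `H ≤ C` and any blow-up `π : X' → X` along `C`, IF `𝓘(D)|_{V(H')}` is an effective Cartier divisor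
(hypothesis `hE`, the output of (a); for regular `V(H) ⊇ V(C)` of any codimension in a regular `X` it is the chart
computation «`𝓘_Y 𝒪 = 𝓘(D) · 𝓘_{Y'}`», not done here), THEN

* `IsBlowup.isBlowup_subscheme_controlledTransform_of_isEffectiveCartier` — every morphism `V(H') → V(H)` over `π`
  is a blow-up of `V(H)` along `C|_{V(H)}` (proof (b) of `HypersurfaceRestriction.lean`, verbatim);
* **`IsBlowup.ker_strictTransformHom_of_isEffectiveCartier`** — for a closed immersion `k : W → X` with `ker k ≤ C`
  (i.e. `V(C) ⊆ W`) and a blow-up `ρ : W' → W` along `C|_W`, the kernel of the strict-transform morphism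
  `Bl_C(k) : W' → X'` (`IsBlowup.strictTransformHom`, GW 13.91 (1)) IS the controlled transform:
  **`ker Bl_C(k) = (π^*(ker k) : 𝓘(D))`** — the ideal of the strict transform of `W` is obtained from the total
  transform by dividing ONCE by the exceptional divisor (uniqueness of blow-ups + uniqueness of morphisms into a
  blow-up, as in `blowup.ker_pushforwardMap` of `HypersurfacePushforward.lean` for Kollár's embedding).

Consumer: the Hironaka-2017 typing's §3.2 (rows 026/027: LSBs induced on a smooth `Y`, `𝔖((I(Y),1))`, GAP row R81),
where (a) is supplied for regular `Y` by a separate local lemma.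

## Sources
* [BGMW 2011] §4 Remark (3); §3.6 Lemma 3.6.4 (6) (arXiv:1206.3090, pp. 8, 11). [BierstoneGrigorievMilmanWlodarczyk2011]
* U. Görtz, T. Wedhorn, *Algebraic Geometry I*, 2nd ed. (2020), Prop. 13.91 (1), Prop. 13.96 (2), (13.19) p. 413–416.
  [GortzWedhorn2020]
-/

noncomputable section

open CategoryTheory CategoryTheory.Limits AlgebraicGeometry TopologicalSpace

namespace Literature.AlgebraicGeometry.Resolution

universe u

section Restriction

variable {X X' : Scheme.{u}} [IsLocallyNoetherian X] {π : X' ⟶ X} {C H : X.IdealSheafData}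

/-- **The restriction property, formal half**: for a blow-up `π : X' → X` along `C`, ideal sheaves `H ≤ C`, and
`H' = (π^*H : 𝓘(D))` the controlled transform with exponent `1`, IF the exceptional divisor restricts to an effective
Cartier divisor on `V(H')`, then every morphism `πS : V(H') → V(H)` over `π` is a blow-up of `V(H)` along `C|_{V(H)}`.
(Universality: a morphism `f : W → V(H)` pulling `C` back to a Cartier divisor lifts to `g : W → X'`; `g` lands in
`V(H')` because `π^*H = 𝓘(D)·H'` with `g^*𝓘(D)` Cartier and `g^*π^*H = f^*(H|_{V(H)}) = 0`.)
[cite: BierstoneGrigorievMilmanWlodarczyk2011, §4 Remark (3)] -/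
theorem IsBlowup.isBlowup_subscheme_controlledTransform_of_isEffectiveCartier (hπ : IsBlowup π C) (hHC : H ≤ C)
    (hE : IsEffectiveCartier ((C.comap π).comap (controlledTransform π C H 1).subschemeι))
    (πS : (controlledTransform π C H 1).subscheme ⟶ H.subscheme)
    (hπS : πS ≫ H.subschemeι = (controlledTransform π C H 1).subschemeι ≫ π) :
    IsBlowup πS (C.comap H.subschemeι) := by
  haveI : IsProper π := hπ.isProper
  haveI : IsLocallyNoetherian X' := LocallyOfFiniteType.isLocallyNoetherian π
  constructor
  · -- the exceptional locus on `V(H')` is effective Cartier (hypothesis)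
    rw [← Scheme.IdealSheafData.comap_comp, hπS, Scheme.IdealSheafData.comap_comp]
    exact hE
  · -- universality (as in `IsBlowup.isBlowup_subscheme_controlledTransform`)
    intro W f hf
    have hf' : IsEffectiveCartier (C.comap (f ≫ H.subschemeι)) := by
      rwa [Scheme.IdealSheafData.comap_comp]
    obtain ⟨g, hg, hgu⟩ := hπ.universal (f ≫ H.subschemeι) hf'
    have hDg : IsEffectiveCartier ((C.comap π).comap g) := by
      rwa [← Scheme.IdealSheafData.comap_comp, hg]
    have hprod : (C.comap π).comap g * (controlledTransform π C H 1).comap g = ⊥ := by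
      rw [← comap_mul]
      have hle : H.comap π ≤ C.comap π ^ 1 := by
        rw [pow_one]
        exact Scheme.IdealSheafData.comap_mono (f := π) hHC
      have h := pow_mul_controlledTransform_eq π C (I := H) (μ := 1) hπ.isEffectiveCartier hle
      rw [pow_one] at h
      rw [h, ← Scheme.IdealSheafData.comap_comp, hg, Scheme.IdealSheafData.comap_comp,
        comap_subschemeι_self, comap_bot]
    have hle : (controlledTransform π C H 1).subschemeι.ker ≤ g.ker := by
      rw [Scheme.IdealSheafData.ker_subschemeι, le_ker_iff_comap_eq_bot]
      exact hDg.eq_bot_of_mul_eq_bot hprod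
    refine ⟨IsClosedImmersion.lift (controlledTransform π C H 1).subschemeι g hle, ?_, ?_⟩
    · show IsClosedImmersion.lift (controlledTransform π C H 1).subschemeι g hle ≫ πS = f
      rw [← cancel_mono H.subschemeι, Category.assoc, hπS, IsClosedImmersion.lift_fac_assoc, hg]
    · intro g' hg'
      change g' ≫ πS = f at hg'
      rw [← cancel_mono (controlledTransform π C H 1).subschemeι, IsClosedImmersion.lift_fac]
      apply hgu
      show (g' ≫ (controlledTransform π C H 1).subschemeι) ≫ π = f ≫ H.subschemeι
      rw [Category.assoc, ← hπS, ← Category.assoc, hg']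

end Restriction

/-! ## The ideal of the strict transform of a closed subscheme through the centre -/

section StrictTransform

variable {X X' W W' : Scheme.{u}} [IsLocallyNoetherian X] {C : X.IdealSheafData} {k : W ⟶ X}
  [IsClosedImmersion k] {π : X' ⟶ X} {ρ : W' ⟶ W}

/-- **`ker Bl_C(k) = (π^*(ker k) : 𝓘(D))`.** Let `k : W → X` be a closed immersion with `ker k ≤ C` (`V(C) ⊆ W`),
`π : X' → X` a blow-up along `C`, `ρ : W' → W` a blow-up along `C|_W`, and `Bl_C(k) : W' → X'` the strict-transform
morphism (GW 13.91 (1), `IsBlowup.strictTransformHom`). IF the exceptional divisor restricts to an effective Cartier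
divisor on `V(H')`, `H' = (π^*(ker k) : 𝓘(D))`, then `ker Bl_C(k) = H'`: both `W'` and `V(H')` are blow-ups of
`W ≅ V(ker k)` along `C|_W`, hence isomorphic over `W`, and morphisms into the blow-up `X'` over `X` are unique.
[cite: GortzWedhorn2020, Prop. 13.91 (1) and Prop. 13.96 (2), p. 414–416] -/
theorem IsBlowup.ker_strictTransformHom_of_isEffectiveCartier (hπ : IsBlowup π C) (hρ : IsBlowup ρ (C.comap k))
    (hCk : k.ker ≤ C)
    (hE : IsEffectiveCartier ((C.comap π).comap (controlledTransform π C k.ker 1).subschemeι)) :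
    (hπ.strictTransformHom hρ).ker = controlledTransform π C k.ker 1 := by
  obtain ⟨πS, hπS⟩ := exists_hom_subscheme_controlledTransform π C k.ker
  have hbl : IsBlowup πS (C.comap k.ker.subschemeι) :=
    hπ.isBlowup_subscheme_controlledTransform_of_isEffectiveCartier hCk hE πS hπS
  -- `W ≅ V(ker k)` through `k.toImage`
  haveI : IsIso k.toImage := inferInstance
  let eS : W ≅ k.ker.subscheme := asIso k.toImage
  have heS : eS.hom ≫ k.ker.subschemeι = k := k.toImage_imageι
  have hinv : eS.inv ≫ k = k.ker.subschemeι := by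
    rw [show eS.inv ≫ k = eS.inv ≫ eS.hom ≫ k.ker.subschemeι by rw [heS], eS.inv_hom_id_assoc]
  -- `W' → W ≅ V(ker k)` is a blow-up along `C|_{V(ker k)}`
  have hbl' : IsBlowup (ρ ≫ eS.hom) (C.comap k.ker.subschemeι) := by
    have h1 := hρ.comp_iso eS
    have h2 : (C.comap k).comap eS.inv = C.comap k.ker.subschemeι := by
      rw [← Scheme.IdealSheafData.comap_comp, hinv]
    rwa [h2] at h1
  obtain ⟨e, he, -⟩ := hbl'.unique hbl
  -- uniqueness of morphisms `W' → X'` over `X`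
  have hj : hπ.strictTransformHom hρ = e.hom ≫ (controlledTransform π C k.ker 1).subschemeι := by
    symm
    apply hπ.eq_strictTransformHom hρ
    rw [Category.assoc, ← hπS, reassoc_of% he, heS]
  rw [hj, Scheme.Hom.ker_comp_of_isIso, Scheme.IdealSheafData.ker_subschemeι]

end StrictTransform

/-! ## From an affine cancellation lemma to the Cartier hypothesis -/

section Affine

variable {X X' : Scheme.{u}} {π : X' ⟶ X} {C H : X.IdealSheafData}

/-- **The Cartier hypothesis from an affine cancellation lemma.** If on every affine open `V ⊆ X'` where the exceptional
ideal is principal, `𝓘(D)(V) = (g₀)`, multiplication by `g₀` is injective modulo `H'(V)` (`s g₀ ∈ H'(V) ⇒ s ∈ H'(V)`,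
`H' = (π^*H : 𝓘(D))`), then the exceptional divisor restricts to an effective Cartier divisor on `V(H')`. This is the
formal shell of `IsBlowup.isEffectiveCartier_comap_subschemeι_controlledTransform` (`HypersurfaceRestriction.lean`),
with its local lemma `mem_ideal_of_mul_mem_of_hypersurface` abstracted into the hypothesis `haff` (supplied for a regular
hypersurface there, and for a regular `V(H) ⊇ V(C)` of any codimension by the regular-pair chart computation).
[cite: BierstoneGrigorievMilmanWlodarczyk2011, Lemma 3.6.4 (6) and §4 Remark (3)] -/
theorem IsBlowup.isEffectiveCartier_comap_subschemeι_controlledTransform_of_affine (hπ : IsBlowup π C)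
    (haff : ∀ (V : X'.affineOpens) (g₀ s : Γ(X', V)), (C.comap π).ideal V = Ideal.span {g₀} →
      s * g₀ ∈ (controlledTransform π C H 1).ideal V → s ∈ (controlledTransform π C H 1).ideal V) :
    IsEffectiveCartier ((C.comap π).comap (controlledTransform π C H 1).subschemeι) := by
  intro s
  obtain ⟨V, hxV, g₀, hg₀, hDV⟩ :=
    hπ.isEffectiveCartier ((controlledTransform π C H 1).subschemeι s)
  let U' : (controlledTransform π C H 1).subscheme.affineOpens :=
    ⟨(controlledTransform π C H 1).subschemeι ⁻¹ᵁ (V : X'.Opens), V.2.preimage _⟩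
  have hsU' : s ∈ (U' : (controlledTransform π C H 1).subscheme.Opens) := hxV
  refine ⟨U', hsU', (controlledTransform π C H 1).subschemeι.app V g₀, ?_, ?_⟩
  · -- nonzerodivisor
    rw [mem_nonZeroDivisors_iff_right]
    intro y hy
    obtain ⟨s₁, rfl⟩ := (controlledTransform π C H 1).subschemeι_app_surjective V y
    have hmem : s₁ * g₀ ∈ RingHom.ker ((controlledTransform π C H 1).subschemeι.app V).hom := by
      rw [RingHom.mem_ker, map_mul]
      exact hy
    rw [Scheme.IdealSheafData.ker_subschemeι_app] at hmem
    have hs₁ := haff V g₀ s₁ hDV hmem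
    rw [← Scheme.IdealSheafData.ker_subschemeι_app (controlledTransform π C H 1) V] at hs₁
    exact hs₁
  · -- the ideal
    rw [ideal_comap_of_le (controlledTransform π C H 1).subschemeι (C.comap π) V U' le_rfl, hDV,
      Ideal.map_span, Set.image_singleton, ← Scheme.Hom.app_eq_appLE]

end Affine

end Literature.AlgebraicGeometry.Resolution

end
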